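import Literature.AlgebraicTopology.SingularHomology.CupRightComparison
import Literature.AlgebraicTopology.SingularHomology.CupRightPullback
import Literature.AlgebraicTopology.SingularHomology.LerayHirschGluing
import Literature.AlgebraicTopology.SingularHomology.CohomologyMayerVietorisInjective
import HarnessLib

/-!
# Suspension step for two-summand decompositions of the cohomology of subsets

Topic `Literature/AlgebraicTopology/SingularHomology`. A. Hatcher, *Algebraic Topology* (2002),
§3.1 p. 204 (Mayer–Vietoris) and Example 3.? / Thm. 3.16 background (`H*(X × Sⁿ) ≅ H*(X) ⊗ H*(Sⁿ)`
by induction over hemispheres); D. Husemoller, *Fibre Bundles*, 3rd ed. (1994), Ch. 17 §1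
(Leray–Hirsch over a product with a trivial factor, "directly from the Künneth formula") and §2
(2.3) (the fibre `ℂPⁿ⁻¹`, whose complement-of-a-hyperplane pieces are cells and spheres).

Abstract form used for the spheres `U × (ℝᴺ⁺¹ ∖ 0)` of the projective-bundle argument.  Fix a
map `p : X → T` ("projection to the base") and, for `W ⊆ X`, the pull-back of base classes
`pullT p W : Hʲ(T; R) → Hʲ_X(W)` (through the comparison `Hʲ_X(W) ≅ Hʲ(↥W)`).  A class
`s ∈ Hᴺ_X(S)` gives a **two-summand decomposition** of `H*_X(S)` (`TwoSummand p S N s`) when every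
class of `Hʲ_X(S)` is uniquely `p*(a) + s ⌣ p^♯φ` (`a ∈ Hʲ(T)`, `φ` a cocycle of `T` of degree
`j - N`; no second summand below degree `N`).  We PROVE:

* `pullT`, `resH_pullT`, `cupRightH_pullT` (`(p* a) ⌣ p^♯φ = p*(a ⌣ φ)`), `mvδ_pullT`;
* `subsetCochains.subsingleton_homology_empty` — `H*_X(∅) = 0`;
* `TwoSummand.union` — **suspension step**: if `p*` is bijective onto `H*_X(W)` and `H*_X(Y)`
  (`W`, `Y` open) and `s` decomposes `H*_X(W ∩ Y)` in degree `N`, then the Mayer–Vietoris image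
  `δ s` decomposes `H*_X(W ∪ Y)` in degree `N + 1`;
* `TwoSummand.of_disjoint` — **base**: for disjoint such `W`, `Y` the class `s₀ ∈ H⁰_X(W ⊔ Y)`
  which is `p*1` on `W` and `0` on `Y` decomposes in degree `0`.

Everything is proved; no named facts.

## References

* [HatcherAT2002] A. Hatcher, *Algebraic Topology*, CUP 2002, §3.1 p. 204; §3.2 Prop. 3.10.
* [HusemollerFibreBundles1994] D. Husemoller, *Fibre Bundles*, 3rd ed. (1994), Ch. 17 §1
  Thm. 1.1, §2 (2.3).
-/

noncomputable section

-- as in `CupRightComparison`: chains of the concrete complex are `Finsupp`s up to unfolding of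
-- semireducible definitions
set_option backward.isDefEq.respectTransparency false

open CategoryTheory Limits

universe u v

namespace Literature.AlgebraicTopology.SingularHomology

namespace subsetCochains

variable {R : Type v} [CommRing R] {X T : Type u} [TopologicalSpace X] [TopologicalSpace T]
  (p : C(X, T))

/-- Local notation: the coefficient object `ULift R` of `ModuleCat.{max u v} R`. -/
local notation "𝑹" => SimplexSpan.coefR R

/-! ### `H*_X(∅) = 0` -/

omit [TopologicalSpace T] in
/-- A cochain of the empty subset is zero (no simplex has empty image). [folklore] -/
theorem eq_zero_of_empty {k : ℕ} (ψ : (subsetCochains R 𝑹 (∅ : Set X)).X k) : ψ = 0 := by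
  refine (SimplexSpan.ofSet (R := R) (∅ : Set X)).hom_ext_toFun fun σ hσ ↦ ?_
  exact absurd (hσ.antisymm (Set.empty_subset _)) (by
    intro h
    obtain ⟨x, hx⟩ := σ.range_nonempty
    rw [h] at hx
    exact hx)

omit [TopologicalSpace T] in
/-- **`Hᵏ_X(∅) = 0`.** [folklore] -/
theorem subsingleton_homology_empty (k : ℕ) :
    Subsingleton ((subsetCochains R 𝑹 (∅ : Set X)).homology k) := by
  refine ⟨fun a b ↦ ?_⟩
  obtain ⟨ψ, hψ, rfl⟩ := homologyCls_surjective a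
  obtain ⟨ψ', hψ', rfl⟩ := homologyCls_surjective b
  exact homologyCls_congr ((eq_zero_of_empty ψ).trans (eq_zero_of_empty ψ').symm) _ _

/-! ### Pull-back of base classes -/

/-- **Pull-back of base classes `p* : Hʲ(T; R) → Hʲ_X(W)`**, through the comparison
`Hʲ_X(W) ≅ Hʲ(↥W)` and the map `p ∘ (↥W → X)`. [cite: HatcherAT2002, §3.1 p. 199] -/
def pullT (W : Set X) (j : ℕ) : singularCohomology R R T j →ₗ[R] (subsetCochains R 𝑹 W).homology j :=
  (homologyIsoSingularCohomology R W j).inv.hom ∘ₗ (singularCohomology.map R R (p.comp (valMap W)) j).hom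

/-- `p*` under the comparison isomorphism. [folklore] -/
theorem iso_pullT (W : Set X) (j : ℕ) (a : singularCohomology R R T j) :
    (homologyIsoSingularCohomology R W j).hom (pullT p W j a) =
      singularCohomology.map R R (p.comp (valMap W)) j a := by
  change ((homologyIsoSingularCohomology R W j).inv ≫ (homologyIsoSingularCohomology R W j).hom) _ = _
  rw [Iso.inv_hom_id]
  rfl

/-- The comparison isomorphism is injective. [folklore] -/
theorem iso_injective (W : Set X) (j : ℕ) : Function.Injective (homologyIsoSingularCohomology R W j).hom :=
  ((ConcreteCategory.isIso_iff_bijective (homologyIsoSingularCohomology R W j).hom).1 inferInstance).1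

/-- **`p*` commutes with restriction.** [folklore] -/
theorem resH_pullT {W W' : Set X} (h : W' ⊆ W) (j : ℕ) (a : singularCohomology R R T j) :
    resH (N := 𝑹) h j (pullT p W j a) = pullT p W' j a := by
  apply iso_injective
  rw [homologyIsoSingularCohomology_hom_resH, iso_pullT, iso_pullT, ← ModuleCat.comp_apply,
    ← singularCohomology.map_comp]
  rfl

/-- `p*` is bijective onto `Hʲ_X(W)` iff `(p ∘ (↥W → X))*` is bijective. [folklore] -/
theorem pullT_bijective_iff (W : Set X) (j : ℕ) :
    Function.Bijective (pullT (R := R) p W j) ↔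
      Function.Bijective (singularCohomology.map R R (p.comp (valMap W)) j) := by
  have e := (ConcreteCategory.isIso_iff_bijective (homologyIsoSingularCohomology R W j).inv).1 inferInstance
  exact Function.Bijective.of_comp_iff' e _

/-- The class of the pulled-back cocycle is the pulled-back class. [folklore] -/
theorem clsOfCocycle_map {e : ℕ} (φ : SingularSimplex T e → R)
    (hφ : (singularCochainComplex R R T).d e (e + 1) φ = 0) :
    clsOfCocycle ((singularCochainComplex.map R R p).f e φ) (map_d_eq_zero p φ hφ) =
      singularCohomology.map R R p e (clsOfCocycle φ hφ) :=
  (homologyMap_homologyCls (singularCochainComplex.map R R p) φ _).symm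

/-- **`(p* a) ⌣ p^♯φ = p*(a ⌣ φ)`**: the action of a pulled-back base cocycle on a pulled-back base
class (Hatcher 2002, Prop. 3.10). [cite: HatcherAT2002, §3.2 Prop. 3.10] -/
theorem cupRightH_pullT (W : Set X) {d e j : ℕ} (h : d + e = j) (φ : SingularSimplex T e → R)
    (hφ : (singularCochainComplex R R T).d e (e + 1) φ = 0) (a : singularCohomology R R T d) :
    (SimplexSpan.ofSet (R := R) W).cupRightH (SimplexSpan.frontBackClosed_ofSet _)
        ((singularCochainComplex.map R R p).f e φ) (map_d_eq_zero p φ hφ) h (pullT p W d a) =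
      pullT p W j (cupProduct h a (clsOfCocycle φ hφ)) := by
  apply iso_injective
  rw [homologyIsoSingularCohomology_hom_cupRightH, iso_pullT, iso_pullT, clsOfCocycle_map,
    ← ModuleCat.comp_apply, ← singularCohomology.map_comp, cupProduct_map]

/-- `δ` kills pulled-back base classes on an intersection (they extend to `W`). [folklore] -/
theorem mvδ_pullT {W Y : Set X} (hW : IsOpen W) (hY : IsOpen Y) (j : ℕ) (a : singularCohomology R R T j) :
    mvδ R 𝑹 hW hY j (pullT p (W ∩ Y) j a) = 0 := by
  rw [← resH_pullT p (Set.inter_subset_left : W ∩ Y ⊆ W)]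
  exact mvδ_res_left hW hY _

/-- The difference of restrictions of pulled-back base classes is a pulled-back base class. [folklore] -/
theorem resH_pullT_sub_resH_pullT {W Y : Set X} (j : ℕ) (a c : singularCohomology R R T j) :
    resH (N := 𝑹) (Set.inter_subset_left : W ∩ Y ⊆ W) j (pullT p W j a) -
        resH (N := 𝑹) (Set.inter_subset_right : W ∩ Y ⊆ Y) j (pullT p Y j c) =
      pullT p (W ∩ Y) j (a - c) := by
  rw [resH_pullT, resH_pullT, map_sub]

/-! ### The action of pulled-back base cocycles on a class -/

/-- **`s ⌣ p^♯φ`**: the action of the pulled-back base cocycle `φ` on a class `s ∈ Hᴺ_X(S)`. [cite: HatcherAT2002, §3.2 p. 209] -/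
def sAct (S : Set X) {N e j : ℕ} (h : N + e = j) (φ : SingularSimplex T e → R)
    (hφ : (singularCochainComplex R R T).d e (e + 1) φ = 0) :
    (subsetCochains R 𝑹 S).homology N →ₗ[R] (subsetCochains R 𝑹 S).homology j :=
  (SimplexSpan.ofSet (R := R) S).cupRightH (SimplexSpan.frontBackClosed_ofSet _)
    ((singularCochainComplex.map R R p).f e φ) (map_d_eq_zero p φ hφ) h

/-- `sAct` is `cupRightH` of the pulled-back cocycle. [folklore] -/
theorem sAct_apply (S : Set X) {N e j : ℕ} (h : N + e = j) (φ : SingularSimplex T e → R)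
    (hφ : (singularCochainComplex R R T).d e (e + 1) φ = 0) (s : (subsetCochains R 𝑹 S).homology N) :
    sAct p S h φ hφ s = (SimplexSpan.ofSet (R := R) S).cupRightH (SimplexSpan.frontBackClosed_ofSet _)
      ((singularCochainComplex.map R R p).f e φ) (map_d_eq_zero p φ hφ) h s := rfl

/-- **`(p* a) ⌣ p^♯φ = p*(a ⌣ φ)`** for `sAct`. [cite: HatcherAT2002, §3.2 Prop. 3.10] -/
theorem sAct_pullT (S : Set X) {N e j : ℕ} (h : N + e = j) (φ : SingularSimplex T e → R)
    (hφ : (singularCochainComplex R R T).d e (e + 1) φ = 0) (a : singularCohomology R R T N) :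
    sAct p S h φ hφ (pullT p S N a) = pullT p S j (cupProduct h a (clsOfCocycle φ hφ)) :=
  cupRightH_pullT p S h φ hφ a

/-- `sAct` commutes with restriction. [folklore] -/
theorem resH_sAct {S S' : Set X} (hS : S' ⊆ S) {N e j : ℕ} (h : N + e = j) (φ : SingularSimplex T e → R)
    (hφ : (singularCochainComplex R R T).d e (e + 1) φ = 0) (s : (subsetCochains R 𝑹 S).homology N) :
    resH (N := 𝑹) hS j (sAct p S h φ hφ s) = sAct p S' h φ hφ (resH (N := 𝑹) hS N s) :=
  (SimplexSpan.ofSet (R := R) S).homologyMap_dualMap_cupRightH (SimplexSpan.frontBackClosed_ofSet _)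
    _ _ (SimplexSpan.ofSet (R := R) S') (chainsInSub_mono R R hS) (SimplexSpan.frontBackClosed_ofSet _)
    (fun hσ ↦ hσ.trans hS) h s

/-- **`δ(s ⌣ p^♯φ) = δ(s) ⌣ p^♯φ`** for `sAct` (`mvδ_cupRightH`). [cite: HusemollerFibreBundles1994, Ch. 17 §1 Thm. 1.1 (proof)] -/
theorem mvδ_sAct {W Y : Set X} (hW : IsOpen W) (hY : IsOpen Y) {N e j : ℕ} (h : N + e = j)
    (φ : SingularSimplex T e → R) (hφ : (singularCochainComplex R R T).d e (e + 1) φ = 0)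
    (s : (subsetCochains R 𝑹 (W ∩ Y)).homology N) :
    mvδ R 𝑹 hW hY j (sAct p (W ∩ Y) h φ hφ s) =
      sAct p (W ∪ Y) (show (N + 1) + e = j + 1 by omega) φ hφ (mvδ R 𝑹 hW hY N s) :=
  mvδ_cupRightH _ _ hW hY h s

/-- `⌣` with the zero cochain vanishes. [folklore] -/
theorem cupRight_zero_right (𝒮 : SimplexSpan R X) {N e j : ℕ} (h : N + e = j) (ψ : 𝒮.sub.toComplex.X N ⟶ 𝑹) :
    𝒮.cupRight (0 : SingularSimplex X e → R) h ψ = 0 := by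
  refine 𝒮.hom_ext_toFun fun τ hτ ↦ ?_
  rw [𝒮.toFun_cupRight _ _ _ hτ, cochainCup_apply, Pi.zero_apply, mul_zero, 𝒮.toFun_zero, Pi.zero_apply]

/-- `sAct` of the zero cocycle vanishes. [folklore] -/
theorem sAct_zero (S : Set X) {N e j : ℕ} (h : N + e = j)
    (h0 : (singularCochainComplex R R T).d e (e + 1) (0 : SingularSimplex T e → R) = 0)
    (s : (subsetCochains R 𝑹 S).homology N) : sAct p S h 0 h0 s = 0 := by
  obtain ⟨ψ, hψ, rfl⟩ := homologyCls_surjective s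
  rw [sAct_apply, (SimplexSpan.ofSet (R := R) S).cupRightH_homologyCls]
  have hz : (SimplexSpan.ofSet (R := R) S).cupRight ((singularCochainComplex.map R R p).f e 0) h ψ = 0 := by
    rw [map_zero]
    exact cupRight_zero_right (SimplexSpan.ofSet (R := R) S) h ψ
  exact (homologyCls_congr hz _ (by rw [map_zero])).trans (homologyCls_zero _)

/-! ### Two-summand decompositions -/

/-- **Two-summand decomposition of `H*_X(S)` by a class `s ∈ Hᴺ_X(S)`**: every class is uniquely
`p*(a) + s ⌣ p^♯φ` with `a ∈ H*(T)` and `φ` a cocycle of `T` (no second summand below degree `N`)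
— the shape of `H*(U × Sᴺ) = H*(U) ⊕ H*⁻ᴺ(U)·σ` (Hatcher 2002, Künneth for spheres;
Husemoller Ch. 17 §1, the product case of Leray–Hirsch). [cite: HusemollerFibreBundles1994, Ch. 17 §1 Thm. 1.1 (proof)] -/
structure TwoSummand (S : Set X) (N : ℕ) (s : (subsetCochains R 𝑹 S).homology N) : Prop where
  /-- below degree `N`, `p*` is injective -/
  inj_lt : ∀ j, j < N → ∀ a : singularCohomology R R T j, pullT p S j a = 0 → a = 0
  /-- below degree `N`, `p*` is surjective -/
  surj_lt : ∀ j, j < N → ∀ w : (subsetCochains R 𝑹 S).homology j, ∃ a, w = pullT p S j a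
  /-- uniqueness of the decomposition -/
  inj : ∀ (e j : ℕ) (h : N + e = j) (a : singularCohomology R R T j) (φ : SingularSimplex T e → R)
    (hφ : (singularCochainComplex R R T).d e (e + 1) φ = 0),
    pullT p S j a + sAct p S h φ hφ s = 0 → a = 0 ∧ clsOfCocycle φ hφ = 0
  /-- existence of the decomposition -/
  surj : ∀ (e j : ℕ) (h : N + e = j) (w : (subsetCochains R 𝑹 S).homology j),
    ∃ (a : singularCohomology R R T j) (φ : SingularSimplex T e → R)
      (hφ : (singularCochainComplex R R T).d e (e + 1) φ = 0), w = pullT p S j a + sAct p S h φ hφ s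

namespace TwoSummand

variable {p}

/-- In a two-summand decomposition `p*` is injective in every degree. [folklore] -/
theorem pullT_eq_zero {S : Set X} {N : ℕ} {s : (subsetCochains R 𝑹 S).homology N} (hS : TwoSummand p S N s)
    (j : ℕ) (a : singularCohomology R R T j) (ha : pullT p S j a = 0) : a = 0 := by
  by_cases hj : j < N
  · exact hS.inj_lt j hj a ha
  · obtain ⟨e, rfl⟩ : ∃ e, j = N + e := ⟨j - N, by omega⟩
    have h0 : (singularCochainComplex R R T).d e (e + 1) (0 : SingularSimplex T e → R) = 0 := map_zero _
    refine (hS.inj e (N + e) rfl a 0 h0 ?_).1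
    rw [sAct_zero, add_zero, ha]

end TwoSummand

/-! ### Classes on a union of two pieces with `p*` bijective on the pieces -/

section Pieces

variable {p} {W Y : Set X} (hW : IsOpen W) (hY : IsOpen Y)
  (hbW : ∀ j, Function.Bijective (pullT (R := R) p W j)) (hbY : ∀ j, Function.Bijective (pullT (R := R) p Y j))

include hbW hbY in
/-- On `W ∪ Y`, a class agrees on `W` and on `Y` with a pulled-back base class, provided `p*` is
injective on `W ∩ Y`. [folklore] -/
theorem exists_pullT_res_eq (hinj : ∀ j (a : singularCohomology R R T j), pullT p (W ∩ Y) j a = 0 → a = 0)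
    (j : ℕ) (w : (subsetCochains R 𝑹 (W ∪ Y)).homology j) :
    ∃ a : singularCohomology R R T j,
      resH (N := 𝑹) Set.subset_union_left j (w - pullT p (W ∪ Y) j a) = 0 ∧
        resH (N := 𝑹) Set.subset_union_right j (w - pullT p (W ∪ Y) j a) = 0 := by
  obtain ⟨a, ha⟩ := (hbW j).2 (resH (N := 𝑹) Set.subset_union_left j w)
  obtain ⟨c, hc⟩ := (hbY j).2 (resH (N := 𝑹) Set.subset_union_right j w)
  have hac : a = c := by
    rw [← sub_eq_zero]
    apply hinj
    rw [← resH_pullT_sub_resH_pullT, ha, hc, LHSubset.resH_resH_apply, LHSubset.resH_resH_apply,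
      sub_self]
  subst hac
  refine ⟨a, ?_, ?_⟩
  · rw [map_sub, resH_pullT, ha, sub_self]
  · rw [map_sub, resH_pullT, hc, sub_self]

include hbW hbY in
/-- In degree `0`, every class of `W ∪ Y` is a pulled-back base class. [folklore] -/
theorem exists_eq_pullT_zero (hinj : ∀ j (a : singularCohomology R R T j), pullT p (W ∩ Y) j a = 0 → a = 0)
    (w : (subsetCochains R 𝑹 (W ∪ Y)).homology 0) : ∃ a, w = pullT p (W ∪ Y) 0 a := by
  obtain ⟨a, h1, h2⟩ := exists_pullT_res_eq hbW hbY hinj 0 w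
  exact ⟨a, sub_eq_zero.1 (eq_zero_of_resH_zero _ h1 h2)⟩

include hbW hbY in
/-- In positive degree, every class of `W ∪ Y` is a pulled-back base class plus a `δ`. [folklore] -/
theorem exists_eq_pullT_add_mvδ (hinj : ∀ j (a : singularCohomology R R T j), pullT p (W ∩ Y) j a = 0 → a = 0)
    (j : ℕ) (w : (subsetCochains R 𝑹 (W ∪ Y)).homology (j + 1)) :
    ∃ (a : singularCohomology R R T (j + 1)) (v : (subsetCochains R 𝑹 (W ∩ Y)).homology j),
      w = pullT p (W ∪ Y) (j + 1) a + mvδ R 𝑹 hW hY j v := by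
  obtain ⟨a, h1, h2⟩ := exists_pullT_res_eq hbW hbY hinj (j + 1) w
  obtain ⟨v, hv⟩ := exists_of_res_eq_zero hW hY _ h1 h2
  exact ⟨a, v, by rw [hv, add_sub_cancel]⟩

include hbW in
/-- A pulled-back base class vanishing on `W ∪ Y` is zero. [folklore] -/
theorem eq_zero_of_pullT_union_eq_zero (j : ℕ) (a : singularCohomology R R T j)
    (ha : pullT p (W ∪ Y) j a = 0) : a = 0 := by
  apply (hbW j).1
  rw [← resH_pullT p (Set.subset_union_left : W ⊆ W ∪ Y), ha, map_zero, map_zero]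

/-! ### The suspension step -/

include hbW hbY in
/-- **Suspension step**: if `p*` is bijective onto `H*_X(W)` and `H*_X(Y)` (`W`, `Y` open) and
`s ∈ Hᴺ_X(W ∩ Y)` gives a two-summand decomposition, then so does `δ s ∈ Hᴺ⁺¹_X(W ∪ Y)`
(Mayer–Vietoris; Hatcher 2002, §3.1 p. 204, the computation of `H*(Sⁿ)` by hemispheres, with
parameters). [cite: HatcherAT2002, §3.1 p. 204] -/
theorem TwoSummand.union {N : ℕ} {s : (subsetCochains R 𝑹 (W ∩ Y)).homology N}
    (hS : TwoSummand p (W ∩ Y) N s) : TwoSummand p (W ∪ Y) (N + 1) (mvδ R 𝑹 hW hY N s) where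
  inj_lt j _ a ha := eq_zero_of_pullT_union_eq_zero hbW j a ha
  surj_lt j hj w := by
    obtain _ | j := j
    · exact exists_eq_pullT_zero hbW hbY hS.pullT_eq_zero w
    · obtain ⟨a, v, rfl⟩ := exists_eq_pullT_add_mvδ hW hY hbW hbY hS.pullT_eq_zero j w
      obtain ⟨a', rfl⟩ := hS.surj_lt j (by omega) v
      exact ⟨a, by rw [mvδ_pullT, add_zero]⟩
  inj e j h a φ hφ h0 := by
    have ha : a = 0 := by
      apply (hbW j).1
      have h1 := congrArg (resH (N := 𝑹) (Set.subset_union_left : W ⊆ W ∪ Y) j) h0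
      rw [map_add, resH_pullT, resH_sAct, res_left_mvδ, map_zero, add_zero, map_zero] at h1
      rw [h1, map_zero]
    subst ha
    refine ⟨rfl, ?_⟩
    rw [map_zero, zero_add] at h0
    obtain rfl : j = (N + e) + 1 := by omega
    rw [← mvδ_sAct p hW hY (rfl : N + e = N + e)] at h0
    obtain ⟨α, γ, hαγ⟩ := exists_of_mvδ_eq_zero hW hY _ h0
    obtain ⟨a₁, rfl⟩ := (hbW _).2 α
    obtain ⟨c₁, rfl⟩ := (hbY _).2 γ
    rw [resH_pullT_sub_resH_pullT] at hαγ
    have h2 : pullT p (W ∩ Y) (N + e) (-(a₁ - c₁)) + sAct p (W ∩ Y) rfl φ hφ s = 0 := by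
      rw [hαγ, map_neg, neg_add_cancel]
    exact (hS.inj e (N + e) rfl _ φ hφ h2).2
  surj e j h w := by
    obtain rfl : j = (N + e) + 1 := by omega
    obtain ⟨a, v, rfl⟩ := exists_eq_pullT_add_mvδ hW hY hbW hbY hS.pullT_eq_zero (N + e) w
    obtain ⟨a', φ, hφ, rfl⟩ := hS.surj e (N + e) rfl v
    refine ⟨a, φ, hφ, ?_⟩
    rw [map_add, mvδ_pullT, zero_add, mvδ_sAct]

/-! ### The base: two disjoint pieces -/

/-- The cohomology of an empty intersection is trivial. [folklore] -/
theorem subsingleton_homology_inter_of_disjoint (hdis : W ∩ Y = ∅) (k : ℕ) :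
    Subsingleton ((subsetCochains R 𝑹 (W ∩ Y)).homology k) := by
  rw [hdis]
  exact subsingleton_homology_empty k

include hW hY in
/-- For disjoint open `W`, `Y`, a class of `W ∪ Y` vanishing on both pieces vanishes. [folklore] -/
theorem eq_zero_of_resH_zero_of_disjoint (hdis : W ∩ Y = ∅) (j : ℕ)
    (w : (subsetCochains R 𝑹 (W ∪ Y)).homology j) (h1 : resH (N := 𝑹) Set.subset_union_left j w = 0)
    (h2 : resH (N := 𝑹) Set.subset_union_right j w = 0) : w = 0 := by
  obtain _ | j := j
  · exact eq_zero_of_resH_zero _ h1 h2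
  · obtain ⟨v, hv⟩ := exists_of_res_eq_zero hW hY _ h1 h2
    haveI := subsingleton_homology_inter_of_disjoint (R := R) hdis j
    rw [← hv, Subsingleton.elim v 0, map_zero]

include hW hY in
/-- For disjoint open `W`, `Y`, any two classes on the pieces glue. [folklore] -/
theorem exists_of_disjoint (hdis : W ∩ Y = ∅) (j : ℕ) (α : (subsetCochains R 𝑹 W).homology j)
    (γ : (subsetCochains R 𝑹 Y).homology j) :
    ∃ w : (subsetCochains R 𝑹 (W ∪ Y)).homology j,
      resH (N := 𝑹) Set.subset_union_left j w = α ∧ resH (N := 𝑹) Set.subset_union_right j w = γ := by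
  haveI := subsingleton_homology_inter_of_disjoint (R := R) hdis j
  exact exists_of_res_eq_res hW hY α γ (Subsingleton.elim _ _)

include hW hY hbW hbY in
/-- **Base of the suspension**: for disjoint open `W`, `Y` with `p*` bijective onto `H*_X(W)` and
`H*_X(Y)`, the class `s₀ ∈ H⁰_X(W ⊔ Y)` which is `p*1` on `W` and `0` on `Y` gives a two-summand
decomposition in degree `0` (`H*(U × S⁰) = H*(U) ⊕ H*(U)`). [cite: HatcherAT2002, §3.1 p. 204] -/
theorem TwoSummand.of_disjoint (hdis : W ∩ Y = ∅) :
    ∃ s₀ : (subsetCochains R 𝑹 (W ∪ Y)).homology 0,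
      resH (N := 𝑹) Set.subset_union_left 0 s₀ = pullT p W 0 (singularCohomology.one R T) ∧
      resH (N := 𝑹) Set.subset_union_right 0 s₀ = 0 ∧ TwoSummand p (W ∪ Y) 0 s₀ := by
  obtain ⟨s₀, hs₁, hs₂⟩ := exists_of_disjoint hW hY hdis 0 (pullT p W 0 (singularCohomology.one R T)) 0
  refine ⟨s₀, hs₁, hs₂, ?_⟩
  exact
  { inj_lt := fun j hj ↦ absurd hj (Nat.not_lt_zero j)
    surj_lt := fun j hj ↦ absurd hj (Nat.not_lt_zero j)
    inj := by
      intro e j h a φ hφ h0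
      obtain rfl : e = j := by omega
      have ha : a = 0 := by
        apply (hbY e).1
        have h1 := congrArg (resH (N := 𝑹) (Set.subset_union_right : Y ⊆ W ∪ Y) e) h0
        rw [map_add, resH_pullT, resH_sAct, hs₂, map_zero, add_zero, map_zero] at h1
        rw [h1, map_zero]
      subst ha
      refine ⟨rfl, ?_⟩
      have h1 := congrArg (resH (N := 𝑹) (Set.subset_union_left : W ⊆ W ∪ Y) e) h0
      rw [map_add, resH_pullT, resH_sAct, hs₁, sAct_pullT, map_zero, zero_add, map_zero,
        one_cupProduct] at h1
      exact (hbW e).1 (h1.trans (map_zero _).symm)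
    surj := by
      intro e j h w
      obtain rfl : e = j := by omega
      obtain ⟨α, hα⟩ := (hbW e).2 (resH (N := 𝑹) Set.subset_union_left e w)
      obtain ⟨γ, hγ⟩ := (hbY e).2 (resH (N := 𝑹) Set.subset_union_right e w)
      obtain ⟨φ, hφ', hφ⟩ := homologyCls_surjective (K := singularCochainComplex R R T) (i := e) (α - γ)
      have hφ0 : (singularCochainComplex R R T).d e (e + 1) φ = 0 := (d_next_eq_zero_iff (up_next e) φ).1 hφ'
      refine ⟨γ, φ, hφ0, ?_⟩
      rw [← sub_eq_zero]
      apply eq_zero_of_resH_zero_of_disjoint hW hY hdis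
      · rw [map_sub, map_add, resH_pullT, resH_sAct, hs₁, sAct_pullT, one_cupProduct, ← hα, ← map_add,
          sub_eq_zero]
        congr 1
        rw [clsOfCocycle, add_comm, ← sub_eq_iff_eq_add]
        exact hφ.symm.trans (homologyCls_congr rfl _ _)
      · rw [map_sub, map_add, resH_pullT, resH_sAct, hs₂, map_zero, add_zero, ← hγ, sub_self] }

end Pieces

end subsetCochains

end Literature.AlgebraicTopology.SingularHomology
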